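import Summits.NavierStokesRegularity.NavierStokesRegularity.Theses.AxisymmetricExtremality
import Literature.Analysis.FunctionSpaces.MoserIteration
import Literature.Analysis.FluidPDE.SereginSverakPressureDecayBalls
import HarnessLib

/-!
# Seregin 2020, proof of Thm 2.1, Step III: the Moser iteration `(2.5) ⇒ (2.6)`

Helper toward the stub `stub_seregin2020TypeII` of the crux `AxisymmetricKatoGlobal` (= the named
fact `Literature.Analysis.FluidPDE.Seregin2020_axisymmetricSingularPoint_typeII`, G. Seregin,
Anal. Math. Phys. 10 (2020) Paper 46 = arXiv:2006.04140, Thm 2.1). Step III of the printed proof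
of the swirl bound (2.6) `sup_{Q(1/2)} |σ| ≤ c(M)` (arXiv p. 7): "For `k = 2, 3, …`, set
`m = m_k = (4/3)^k`, `r₁ = r^{(k)} = 1/2 + 2^{-(k+1)}`, `r = r^{(k+1)}`, `Q_k = Q(r^{(k)})`. Then
(2.5) gives `(∫_{Q_{k+1}} |σ|^{10m_k/3})^{3/(10m_k)} ≤ C_k^{1/m_k} (∫_{Q_k} |σ|^{5m_k/2})^{2/(5m_k)}`
… Observing that `10m_k/3 = 5m_{k+1}/2` and applying Moser's arguments, we find
`sup_{Q(1/2)} |σ| ≤ c(M) (∫_{Q(5/8)} |σ|^{5m₂/2})^{2/(5m₂)}`."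

The abstract bookkeeping of Moser's iteration is already in the tree
(`Literature.Analysis.FunctionSpaces.eLpNorm_top_le_of_moser_chain`: chain from index `0`,
exponents `p₀ χ^k`, constants `(C₀ b^k)^{1/p_k}`); this file does not duplicate it but supplies
the forms in which Seregin's (2.5) plugs in:

* `eLpNorm_top_le_of_moser_chain_from` — the abstract chain started at an index `k₀`, with
  per-step constants `C_k^{a/p_k}`, `C_k ≤ K b^k` (`K, b < ∞`; general measure space);
* `eLpNorm_top_le_of_moser_chain_fourThirds` — Seregin's exponents `m_k = (4/3)^k`,
  `p_k = 5m_k/2`, constants `C_k^{1/m_k}`, `k ≥ 2`: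
  `‖f‖_{L^∞(⋂_j A_{2+j})} ≤ K^{9/4} b^{45/4} ‖f‖_{L^{40/9}(A₂)}`
  (`∑_{k≥2} (3/4)^k = 9/4`, `∑_{k≥2} k (3/4)^k = 45/4`);
* `eLpNorm_top_parCyl_half_le_of_reverse_holder` — on Seregin's cylinders
  `Q(r) = 𝒞(r) × ]-r², 0[ = SereginSverak2009.parCyl 0 r`, `Q_k = Q(1/2 + 2^{-(k+1)})`
  (`Q₂ = Q(5/8)`, `⋂ Q_k ⊇ Q(1/2)`), fed with (2.5) in its printed un-rooted form
  (`ω = σ^{m_k}`): `(∫_{Q_{k+1}} |σ|^{10m_k/3})^{3/10} ≤ C_k (∫_{Q_k} |σ|^{5m_k/2})^{2/5}`, giving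
  `‖σ‖_{L^∞(Q(1/2))} ≤ K^{9/4} b^{45/4} (∫_{Q(5/8)} |σ|^{40/9})^{9/40}`;
* `ae_abs_le_parCyl_half_of_reverse_holder`, `ae_abs_le_parabolicCylinder_half_of_reverse_holder`
  — the same as an a.e. bound `|σ| ≤ c` on `Q(1/2)` and on `parabolicCylinder (1/2) 0 ⊆ Q(1/2)`
  (the shape of (2.6) consumed downstream), once `∫_{Q(5/8)} |σ|^{40/9} < ∞` (Step I);
* `stub_seregin2020TypeII_moserIteration` — the registered sub-stub (conjunction).

In Seregin's case `C_k = cM (r^{(k)} − r^{(k+1)})^{-1/2} (r^{(k)}/(r^{(k)} − r^{(k+1)}))² ≤ 32cM·2^{5k/2}`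
(`r^{(k)} − r^{(k+1)} = 2^{-(k+2)}`, `r^{(k)} ≤ 1`): `K = 32cM`, `b = 2^{5/2}`,
`c(M) = (32cM)^{9/4} 2^{225/8}`. Reference: G. Seregin, Anal. Math. Phys. 10 (2020), Paper 46 =
arXiv:2006.04140, proof of Thm 2.1, Step III (arXiv p. 7) [Seregin2020]; J. Moser, Comm. Pure
Appl. Math. 17 (1964) 101–134 (the iteration; folklore).
-/

-- the problem directory repeats the summit name (D-0017); core's `dupNamespace` linter fires
set_option linter.dupNamespace false

noncomputable section

open MeasureTheory Set Function Filter Topology Metric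
open scoped NNReal ENNReal

namespace Summit.NavierStokesRegularity.NavierStokesRegularity.Theorems.AxisymmetricKatoGlobal.EulerScaling

open Literature.Analysis.FluidPDE Literature.Analysis.FunctionSpaces

/-! ### The abstract chain from an index `k₀` -/

/-- **Moser's iteration from an index `k₀`.** Let `A_k` be sets, `p_k = p₀ χ^k` (`p₀ > 0`,
`χ > 1`), `a > 0`, and `K, b < ∞`. If `‖f‖_{L^{p_{k+1}}(A_{k+1})} ≤ C_k^{a/p_k} ‖f‖_{L^{p_k}(A_k)}`
with `C_k ≤ K b^k` for all `k ≥ k₀`, then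
`‖f‖_{L^∞(⋂_j A_{k₀+j})} ≤ (K b^{k₀})^{aχ/(p_{k₀}(χ-1))} b^{aχ/(p_{k₀}(χ-1)²)} ‖f‖_{L^{p_{k₀}}(A_{k₀})}`
(reindex `j = k - k₀` in the tree's `eLpNorm_top_le_of_moser_chain`; the exponents are
`∑_{k≥k₀} a/p_k` split as `(K b^{k₀})^{∑_j a/p_{k₀+j}} b^{∑_j a j/p_{k₀+j}}`). [folklore] -/
theorem eLpNorm_top_le_of_moser_chain_from {α : Type*} [MeasurableSpace α] {μ : Measure α}
    {E : Type*} [NormedAddCommGroup E] {f : α → E} (hf : AEStronglyMeasurable f μ)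
    (A : ℕ → Set α) {p₀ χ a : ℝ} (hp₀ : 0 < p₀) (hχ : 1 < χ) (ha : 0 < a) (k₀ : ℕ)
    {K b : ℝ≥0∞} (hK : K ≠ ∞) (hb : b ≠ ∞) {C : ℕ → ℝ≥0∞} (hC : ∀ k, k₀ ≤ k → C k ≤ K * b ^ k)
    (H : ∀ k, k₀ ≤ k → eLpNorm f (ENNReal.ofReal (p₀ * χ ^ (k + 1))) (μ.restrict (A (k + 1))) ≤
      C k ^ (a / (p₀ * χ ^ k)) * eLpNorm f (ENNReal.ofReal (p₀ * χ ^ k)) (μ.restrict (A k))) :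
    eLpNorm f ∞ (μ.restrict (⋂ j, A (k₀ + j))) ≤
      (K * b ^ k₀) ^ (a * χ / (p₀ * χ ^ k₀ * (χ - 1))) *
        b ^ (a * χ / (p₀ * χ ^ k₀ * (χ - 1) ^ 2)) *
        eLpNorm f (ENNReal.ofReal (p₀ * χ ^ k₀)) (μ.restrict (A k₀)) := by
  have hχ0 : 0 < χ := zero_lt_one.trans hχ
  have hsub : ∀ j, (⋂ i, A (k₀ + i)) ⊆ A (k₀ + j) := fun j => iInter_subset _ j
  -- degenerate constants: `K = 0` or `b = 0` forces `f = 0` a.e. on `A (k₀ + 2)`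
  by_cases h0 : K = 0 ∨ b = 0
  · have hKb : K * b ^ (k₀ + 1) = 0 := by
      rcases h0 with h0 | h0
      · simp [h0]
      · simp [h0, pow_succ]
    have hC1 : C (k₀ + 1) = 0 := le_zero_iff.1 (hKb ▸ hC (k₀ + 1) (Nat.le_succ _))
    have hN2 : eLpNorm f (ENNReal.ofReal (p₀ * χ ^ (k₀ + 1 + 1))) (μ.restrict (A (k₀ + 1 + 1))) = 0 := by
      have h := H (k₀ + 1) (Nat.le_succ _)
      rw [hC1, ENNReal.zero_rpow_of_pos (by positivity), zero_mul] at h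
      exact le_zero_iff.1 h
    have hp2 : ENNReal.ofReal (p₀ * χ ^ (k₀ + 1 + 1)) ≠ 0 :=
      (ENNReal.ofReal_pos.2 (by positivity)).ne'
    have hae : f =ᵐ[μ.restrict (A (k₀ + 2))] 0 := (eLpNorm_eq_zero_iff hf.restrict hp2).1 hN2
    have hae' : f =ᵐ[μ.restrict (⋂ i, A (k₀ + i))] 0 :=
      ae_restrict_of_ae_restrict_of_subset (hsub 2) hae
    rw [eLpNorm_congr_ae hae', eLpNorm_zero]
    exact zero_le
  have hK0 : K ≠ 0 := fun h => h0 (Or.inl h)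
  have hb0 : b ≠ 0 := fun h => h0 (Or.inr h)
  lift K to ℝ≥0 using hK
  lift b to ℝ≥0 using hb
  have hK0' : K ≠ 0 := fun h => hK0 (by simp [h])
  have hb0' : b ≠ 0 := fun h => hb0 (by simp [h])
  have hp₀' : 0 < p₀ * χ ^ k₀ := by positivity
  have hKb : K * b ^ k₀ ≠ 0 := mul_ne_zero hK0' (pow_ne_zero _ hb0')
  have hC₀'0 : (K * b ^ k₀) ^ a ≠ 0 := by
    rw [Ne, NNReal.rpow_eq_zero_iff]
    exact fun h => hKb h.1
  have hb'0 : b ^ a ≠ 0 := by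
    rw [Ne, NNReal.rpow_eq_zero_iff]
    exact fun h => hb0' h.1
  have hcoeC : (((K * b ^ k₀) ^ a : ℝ≥0) : ℝ≥0∞) = ((K : ℝ≥0∞) * (b : ℝ≥0∞) ^ k₀) ^ a := by
    rw [ENNReal.coe_rpow_of_ne_zero hKb, ENNReal.coe_mul, ENNReal.coe_pow]
  have hcoeb : ((b ^ a : ℝ≥0) : ℝ≥0∞) = (b : ℝ≥0∞) ^ a := ENNReal.coe_rpow_of_ne_zero hb0' a
  -- the chain from index `0` for `j ↦ A (k₀ + j)` and the exponents `(p₀ χ^{k₀}) χ^j`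
  have H' : ∀ j : ℕ, eLpNorm f (ENNReal.ofReal (p₀ * χ ^ k₀ * χ ^ (j + 1)))
      (μ.restrict (A (k₀ + (j + 1)))) ≤
      ((((K * b ^ k₀) ^ a : ℝ≥0) : ℝ≥0∞) * ((b ^ a : ℝ≥0) : ℝ≥0∞) ^ j) ^ (1 / (p₀ * χ ^ k₀ * χ ^ j)) *
        eLpNorm f (ENNReal.ofReal (p₀ * χ ^ k₀ * χ ^ j)) (μ.restrict (A (k₀ + j))) := by
    intro j
    have hk : k₀ ≤ k₀ + j := Nat.le_add_right _ _
    have h := H (k₀ + j) hk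
    have e1 : p₀ * χ ^ (k₀ + j + 1) = p₀ * χ ^ k₀ * χ ^ (j + 1) := by ring
    have e2 : p₀ * χ ^ (k₀ + j) = p₀ * χ ^ k₀ * χ ^ j := by ring
    rw [e1, e2] at h
    refine h.trans (mul_le_mul_left ?_ _)
    have hexp : 0 ≤ a / (p₀ * χ ^ k₀ * χ ^ j) := by positivity
    calc C (k₀ + j) ^ (a / (p₀ * χ ^ k₀ * χ ^ j))
        ≤ ((K : ℝ≥0∞) * (b : ℝ≥0∞) ^ (k₀ + j)) ^ (a / (p₀ * χ ^ k₀ * χ ^ j)) :=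
          ENNReal.rpow_le_rpow (hC _ hk) hexp
      _ = ((((K * b ^ k₀) ^ a : ℝ≥0) : ℝ≥0∞) * ((b ^ a : ℝ≥0) : ℝ≥0∞) ^ j) ^
            (1 / (p₀ * χ ^ k₀ * χ ^ j)) := by
          rw [hcoeC, hcoeb, div_eq_mul_one_div a, ENNReal.rpow_mul]
          congr 1
          rw [pow_add, ← mul_assoc, ENNReal.mul_rpow_of_nonneg _ _ ha.le,
            ← ENNReal.rpow_natCast_mul, mul_comm (j : ℝ) a, ENNReal.rpow_mul_natCast]
  have hmain := eLpNorm_top_le_of_moser_chain (μ := μ) hf (A := fun j => A (k₀ + j)) hp₀' hχ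
    hC₀'0 hb'0 H'
  -- identify the constants
  have e3 : ((((K * b ^ k₀) ^ a : ℝ≥0) : ℝ≥0∞)) ^ (χ / (p₀ * χ ^ k₀ * (χ - 1))) =
      ((K : ℝ≥0∞) * (b : ℝ≥0∞) ^ k₀) ^ (a * χ / (p₀ * χ ^ k₀ * (χ - 1))) := by
    rw [hcoeC, ← ENNReal.rpow_mul, mul_div_assoc]
  have e4 : ((b ^ a : ℝ≥0) : ℝ≥0∞) ^ (χ / (p₀ * χ ^ k₀ * (χ - 1) ^ 2)) =
      (b : ℝ≥0∞) ^ (a * χ / (p₀ * χ ^ k₀ * (χ - 1) ^ 2)) := by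
    rw [hcoeb, ← ENNReal.rpow_mul, mul_div_assoc]
  rw [e3, e4] at hmain
  simpa only [add_zero, pow_zero, mul_one] using hmain

/-! ### Seregin's exponents `m_k = (4/3)^k`, `p_k = 5 m_k / 2` -/

/-- **Moser's iteration with Seregin's exponents.** If for all `k ≥ 2`
`‖f‖_{L^{5m_{k+1}/2}(A_{k+1})} ≤ C_k^{1/m_k} ‖f‖_{L^{5m_k/2}(A_k)}`, `m_k = (4/3)^k`, with
`C_k ≤ K b^k` (`K, b < ∞`), then `‖f‖_{L^∞(⋂_j A_{2+j})} ≤ K^{9/4} b^{45/4} ‖f‖_{L^{40/9}(A₂)}`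
(`40/9 = 5m₂/2`; `∑_{k≥2} (3/4)^k = 9/4`, `∑_{k≥2} k(3/4)^k = 45/4`; general measure space).
[cite: Seregin2020, proof of Thm 2.1, Step III] -/
theorem eLpNorm_top_le_of_moser_chain_fourThirds {α : Type*} [MeasurableSpace α] {μ : Measure α}
    {E : Type*} [NormedAddCommGroup E] {f : α → E} (hf : AEStronglyMeasurable f μ)
    (A : ℕ → Set α) {K b : ℝ≥0∞} (hK : K ≠ ∞) (hb : b ≠ ∞) {C : ℕ → ℝ≥0∞}
    (hC : ∀ k, 2 ≤ k → C k ≤ K * b ^ k)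
    (H : ∀ k, 2 ≤ k →
      eLpNorm f (ENNReal.ofReal (5 / 2 * (4 / 3 : ℝ) ^ (k + 1))) (μ.restrict (A (k + 1))) ≤
        C k ^ (1 / (4 / 3 : ℝ) ^ k) *
          eLpNorm f (ENNReal.ofReal (5 / 2 * (4 / 3 : ℝ) ^ k)) (μ.restrict (A k))) :
    eLpNorm f ∞ (μ.restrict (⋂ j, A (2 + j))) ≤
      K ^ (9 / 4 : ℝ) * b ^ (45 / 4 : ℝ) * eLpNorm f (ENNReal.ofReal (40 / 9)) (μ.restrict (A 2)) := by
  have H' : ∀ k, 2 ≤ k →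
      eLpNorm f (ENNReal.ofReal (5 / 2 * (4 / 3 : ℝ) ^ (k + 1))) (μ.restrict (A (k + 1))) ≤
        C k ^ ((5 / 2 : ℝ) / (5 / 2 * (4 / 3 : ℝ) ^ k)) *
          eLpNorm f (ENNReal.ofReal (5 / 2 * (4 / 3 : ℝ) ^ k)) (μ.restrict (A k)) := by
    intro k hk
    have e : (5 / 2 : ℝ) / (5 / 2 * (4 / 3 : ℝ) ^ k) = 1 / (4 / 3 : ℝ) ^ k := by
      rw [div_mul_eq_div_div, div_self (by norm_num : (5 / 2 : ℝ) ≠ 0)]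
    rw [e]
    exact H k hk
  have h := eLpNorm_top_le_of_moser_chain_from hf A (p₀ := 5 / 2) (χ := 4 / 3) (a := 5 / 2)
    (by norm_num) (by norm_num) (by norm_num) 2 hK hb hC H'
  have e1 : (5 / 2 : ℝ) * (4 / 3) / (5 / 2 * (4 / 3 : ℝ) ^ 2 * (4 / 3 - 1)) = 9 / 4 := by norm_num
  have e2 : (5 / 2 : ℝ) * (4 / 3) / (5 / 2 * (4 / 3 : ℝ) ^ 2 * (4 / 3 - 1) ^ 2) = 27 / 4 := by
    norm_num
  have e3 : (5 / 2 * (4 / 3 : ℝ) ^ 2) = 40 / 9 := by norm_num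
  rw [e1, e2, e3] at h
  refine h.trans (le_of_eq ?_)
  congr 1
  by_cases hb0 : b = 0
  · subst hb0
    simp [ENNReal.zero_rpow_of_pos (show (0 : ℝ) < 27 / 4 by norm_num),
      ENNReal.zero_rpow_of_pos (show (0 : ℝ) < 45 / 4 by norm_num)]
  rw [ENNReal.mul_rpow_of_nonneg _ _ (by norm_num), mul_assoc, ← ENNReal.rpow_natCast_mul,
    ← ENNReal.rpow_add _ _ hb0 hb]
  norm_num

/-! ### Seregin's cylinders -/

/-- `‖f‖_{L^q(ν)} = (∫⁻ ‖f‖ₑ^q dν)^{1/q}` for a real exponent `q > 0`. [folklore] -/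
theorem eLpNorm_ofReal_eq_lintegral_rpow {α : Type*} [MeasurableSpace α] {E : Type*}
    [NormedAddCommGroup E] (f : α → E) (ν : Measure α) {q : ℝ} (hq : 0 < q) :
    eLpNorm f (ENNReal.ofReal q) ν = (∫⁻ x, ‖f x‖ₑ ^ q ∂ν) ^ (1 / q) := by
  rw [eLpNorm_eq_lintegral_rpow_enorm_toReal (ENNReal.ofReal_pos.2 hq).ne' ENNReal.ofReal_ne_top,
    ENNReal.toReal_ofReal hq.le]

/-- The radii `r^{(k)} = 1/2 + 2^{-(k+1)}` of Step III: `1/2 < r^{(k)}`, `r^{(k)} ≤ 5/8` for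
`k ≥ 2`, and `r^{(k+1)} ≤ r^{(k)}`. [cite: Seregin2020, proof of Thm 2.1, Step III] -/
theorem moser_radius_fourThirds_bounds (k : ℕ) :
    (1 / 2 : ℝ) < 1 / 2 + (1 / 2 : ℝ) ^ (k + 1) ∧
      (2 ≤ k → 1 / 2 + (1 / 2 : ℝ) ^ (k + 1) ≤ 5 / 8) ∧
      1 / 2 + (1 / 2 : ℝ) ^ (k + 2) ≤ 1 / 2 + (1 / 2 : ℝ) ^ (k + 1) := by
  have h0 : (0 : ℝ) < (1 / 2 : ℝ) ^ (k + 1) := by positivity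
  refine ⟨by linarith, fun hk => ?_, ?_⟩
  · have : (1 / 2 : ℝ) ^ (k + 1) ≤ (1 / 2 : ℝ) ^ 3 :=
      pow_le_pow_of_le_one (by norm_num) (by norm_num) (by omega)
    norm_num at this ⊢
    linarith
  · have : (1 / 2 : ℝ) ^ (k + 2) ≤ (1 / 2 : ℝ) ^ (k + 1) :=
      pow_le_pow_of_le_one (by norm_num) (by norm_num) (by omega)
    linarith

/-- **Seregin 2020, Step III of the proof of (2.6): the Moser iteration on the cylinders
`Q_k = Q(1/2 + 2^{-(k+1)})`, `Q(r) = 𝒞(r) × ]-r², 0[`.** If `σ` is a.e. strongly measurable on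
`Q(5/8) = Q₂` and satisfies the reverse Hölder inequalities (2.5) with `m = m_k = (4/3)^k`,
`r = r^{(k+1)}`, `r₁ = r^{(k)}` in their printed (un-rooted, `ω = σ^m`) form
`(∫_{Q_{k+1}} |σ|^{10m_k/3})^{3/10} ≤ C_k (∫_{Q_k} |σ|^{5m_k/2})^{2/5}` for `k ≥ 2`, with
`C_k ≤ K b^k`, `K, b < ∞`, then
`‖σ‖_{L^∞(Q(1/2))} ≤ K^{9/4} b^{45/4} (∫_{Q(5/8)} |σ|^{40/9})^{9/40}` ("observing that
`10m_k/3 = 5m_{k+1}/2` and applying Moser's arguments"). [cite: Seregin2020, proof of Thm 2.1, Step III] -/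
theorem eLpNorm_top_parCyl_half_le_of_reverse_holder {σ : ℝ × EuclideanSpace ℝ (Fin 3) → ℝ}
    (hσ : AEStronglyMeasurable σ
      (volume.restrict (SereginSverak2009.parCyl (0 : ℝ × EuclideanSpace ℝ (Fin 3)) (5 / 8))))
    {C : ℕ → ℝ≥0∞} {K b : ℝ≥0∞} (hK : K ≠ ∞) (hb : b ≠ ∞) (hC : ∀ k, 2 ≤ k → C k ≤ K * b ^ k)
    (H : ∀ k : ℕ, 2 ≤ k →
      (∫⁻ z in SereginSverak2009.parCyl (0 : ℝ × EuclideanSpace ℝ (Fin 3))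
          (1 / 2 + (1 / 2 : ℝ) ^ (k + 2)), ‖σ z‖ₑ ^ (10 / 3 * (4 / 3 : ℝ) ^ k)) ^ (3 / 10 : ℝ) ≤
        C k * (∫⁻ z in SereginSverak2009.parCyl (0 : ℝ × EuclideanSpace ℝ (Fin 3))
          (1 / 2 + (1 / 2 : ℝ) ^ (k + 1)), ‖σ z‖ₑ ^ (5 / 2 * (4 / 3 : ℝ) ^ k)) ^ (2 / 5 : ℝ)) :
    eLpNorm σ ∞ (volume.restrict (SereginSverak2009.parCyl (0 : ℝ × EuclideanSpace ℝ (Fin 3)) (1 / 2))) ≤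
      K ^ (9 / 4 : ℝ) * b ^ (45 / 4 : ℝ) *
        (∫⁻ z in SereginSverak2009.parCyl (0 : ℝ × EuclideanSpace ℝ (Fin 3)) (5 / 8),
          ‖σ z‖ₑ ^ (40 / 9 : ℝ)) ^ (9 / 40 : ℝ) := by
  -- the cylinders `A k = Q_k` inside the ambient cylinder `Q(5/8) = Q₂`
  set A : ℕ → Set (ℝ × EuclideanSpace ℝ (Fin 3)) := fun k =>
    SereginSverak2009.parCyl (0 : ℝ × EuclideanSpace ℝ (Fin 3)) (1 / 2 + (1 / 2 : ℝ) ^ (k + 1)) with hA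
  set μ : Measure (ℝ × EuclideanSpace ℝ (Fin 3)) :=
    volume.restrict (SereginSverak2009.parCyl (0 : ℝ × EuclideanSpace ℝ (Fin 3)) (5 / 8)) with hμ
  have hr := moser_radius_fourThirds_bounds
  have hAsub : ∀ k, 2 ≤ k →
      A k ⊆ SereginSverak2009.parCyl (0 : ℝ × EuclideanSpace ℝ (Fin 3)) (5 / 8) := fun k hk =>
    SereginSverak2009.parCyl_mono 0 (by positivity) ((hr k).2.1 hk)
  have hrestr : ∀ k, 2 ≤ k → μ.restrict (A k) = volume.restrict (A k) := fun k hk => by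
    rw [hμ]
    exact Measure.restrict_restrict_of_subset (hAsub k hk)
  have hA2 : A 2 = SereginSverak2009.parCyl (0 : ℝ × EuclideanSpace ℝ (Fin 3)) (5 / 8) := by
    show SereginSverak2009.parCyl (0 : ℝ × EuclideanSpace ℝ (Fin 3)) (1 / 2 + (1 / 2 : ℝ) ^ (2 + 1)) = _
    norm_num
  -- the chain in `eLpNorm` form (take `1/m_k`-th roots of (2.5))
  have Hchain : ∀ k, 2 ≤ k →
      eLpNorm σ (ENNReal.ofReal (5 / 2 * (4 / 3 : ℝ) ^ (k + 1))) (μ.restrict (A (k + 1))) ≤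
        C k ^ (1 / (4 / 3 : ℝ) ^ k) *
          eLpNorm σ (ENNReal.ofReal (5 / 2 * (4 / 3 : ℝ) ^ k)) (μ.restrict (A k)) := by
    intro k hk
    have hq1 : (0 : ℝ) < 5 / 2 * (4 / 3 : ℝ) ^ (k + 1) := by positivity
    have hq0 : (0 : ℝ) < 5 / 2 * (4 / 3 : ℝ) ^ k := by positivity
    have hmk : (4 / 3 : ℝ) ^ k ≠ 0 := by positivity
    rw [hrestr (k + 1) (by omega), hrestr k hk, eLpNorm_ofReal_eq_lintegral_rpow _ _ hq1,
      eLpNorm_ofReal_eq_lintegral_rpow _ _ hq0]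
    have h0 : (∫⁻ z in A (k + 1), ‖σ z‖ₑ ^ (10 / 3 * (4 / 3 : ℝ) ^ k)) ^ (3 / 10 : ℝ) ≤
        C k * (∫⁻ z in A k, ‖σ z‖ₑ ^ (5 / 2 * (4 / 3 : ℝ) ^ k)) ^ (2 / 5 : ℝ) := H k hk
    have h := ENNReal.rpow_le_rpow h0 (by positivity : (0 : ℝ) ≤ 1 / (4 / 3 : ℝ) ^ k)
    rw [ENNReal.mul_rpow_of_nonneg _ _ (by positivity), ← ENNReal.rpow_mul, ← ENNReal.rpow_mul]
      at h
    have e1 : (10 / 3 : ℝ) * (4 / 3 : ℝ) ^ k = 5 / 2 * (4 / 3 : ℝ) ^ (k + 1) := by ring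
    have e2 : (3 / 10 : ℝ) * (1 / (4 / 3 : ℝ) ^ k) = 1 / (5 / 2 * (4 / 3 : ℝ) ^ (k + 1)) := by
      rw [mul_one_div, div_eq_div_iff (by positivity) (by positivity)]
      ring
    have e3 : (2 / 5 : ℝ) * (1 / (4 / 3 : ℝ) ^ k) = 1 / (5 / 2 * (4 / 3 : ℝ) ^ k) := by
      rw [mul_one_div, div_eq_div_iff (by positivity) (by positivity)]
      ring
    rw [e1, e2, e3] at h
    exact h
  have hmain := eLpNorm_top_le_of_moser_chain_fourThirds hσ A hK hb hC Hchain
  -- `Q(1/2) ⊆ ⋂ Q_k ⊆ Q₂ = Q(5/8)`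
  have hIsub : (⋂ j, A (2 + j)) ⊆ SereginSverak2009.parCyl (0 : ℝ × EuclideanSpace ℝ (Fin 3)) (5 / 8) :=
    (iInter_subset _ 0).trans (hAsub 2 le_rfl)
  have hQsub : SereginSverak2009.parCyl (0 : ℝ × EuclideanSpace ℝ (Fin 3)) (1 / 2) ⊆ ⋂ j, A (2 + j) :=
    subset_iInter fun j => SereginSverak2009.parCyl_mono 0 (by norm_num) (hr (2 + j)).1.le
  have hle : volume.restrict (SereginSverak2009.parCyl (0 : ℝ × EuclideanSpace ℝ (Fin 3)) (1 / 2)) ≤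
      μ.restrict (⋂ j, A (2 + j)) := by
    rw [hμ, Measure.restrict_restrict_of_subset hIsub]
    exact Measure.restrict_mono hQsub le_rfl
  calc eLpNorm σ ∞ (volume.restrict (SereginSverak2009.parCyl (0 : ℝ × EuclideanSpace ℝ (Fin 3)) (1 / 2)))
      ≤ eLpNorm σ ∞ (μ.restrict (⋂ j, A (2 + j))) := eLpNorm_mono_measure σ hle
    _ ≤ K ^ (9 / 4 : ℝ) * b ^ (45 / 4 : ℝ) * eLpNorm σ (ENNReal.ofReal (40 / 9)) (μ.restrict (A 2)) :=
        hmain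
    _ = K ^ (9 / 4 : ℝ) * b ^ (45 / 4 : ℝ) *
          (∫⁻ z in SereginSverak2009.parCyl (0 : ℝ × EuclideanSpace ℝ (Fin 3)) (5 / 8),
            ‖σ z‖ₑ ^ (40 / 9 : ℝ)) ^ (9 / 40 : ℝ) := by
        rw [hrestr 2 le_rfl, hA2, eLpNorm_ofReal_eq_lintegral_rpow _ _ (by norm_num : (0 : ℝ) < 40 / 9)]
        norm_num

/-- **(2.6) as an a.e. bound on `Q(1/2)`.** In the setting of
`eLpNorm_top_parCyl_half_le_of_reverse_holder`, if moreover `∫_{Q(5/8)} |σ|^{40/9} < ∞` (Step I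
of the printed proof), then `|σ| ≤ c := (K^{9/4} b^{45/4} (∫_{Q(5/8)} |σ|^{40/9})^{9/40}).toReal`
a.e. on `Q(1/2) = 𝒞(1/2) × ]-1/4, 0[`. [cite: Seregin2020, proof of Thm 2.1, Step III and (2.6)] -/
theorem ae_abs_le_parCyl_half_of_reverse_holder {σ : ℝ × EuclideanSpace ℝ (Fin 3) → ℝ}
    (hσ : AEStronglyMeasurable σ
      (volume.restrict (SereginSverak2009.parCyl (0 : ℝ × EuclideanSpace ℝ (Fin 3)) (5 / 8))))
    {C : ℕ → ℝ≥0∞} {K b : ℝ≥0∞} (hK : K ≠ ∞) (hb : b ≠ ∞) (hC : ∀ k, 2 ≤ k → C k ≤ K * b ^ k)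
    (H : ∀ k : ℕ, 2 ≤ k →
      (∫⁻ z in SereginSverak2009.parCyl (0 : ℝ × EuclideanSpace ℝ (Fin 3))
          (1 / 2 + (1 / 2 : ℝ) ^ (k + 2)), ‖σ z‖ₑ ^ (10 / 3 * (4 / 3 : ℝ) ^ k)) ^ (3 / 10 : ℝ) ≤
        C k * (∫⁻ z in SereginSverak2009.parCyl (0 : ℝ × EuclideanSpace ℝ (Fin 3))
          (1 / 2 + (1 / 2 : ℝ) ^ (k + 1)), ‖σ z‖ₑ ^ (5 / 2 * (4 / 3 : ℝ) ^ k)) ^ (2 / 5 : ℝ))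
    (hfin : (∫⁻ z in SereginSverak2009.parCyl (0 : ℝ × EuclideanSpace ℝ (Fin 3)) (5 / 8),
      ‖σ z‖ₑ ^ (40 / 9 : ℝ)) ≠ ∞) :
    ∀ᵐ z ∂(volume.restrict (SereginSverak2009.parCyl (0 : ℝ × EuclideanSpace ℝ (Fin 3)) (1 / 2))),
      |σ z| ≤ (K ^ (9 / 4 : ℝ) * b ^ (45 / 4 : ℝ) *
        (∫⁻ z in SereginSverak2009.parCyl (0 : ℝ × EuclideanSpace ℝ (Fin 3)) (5 / 8),
          ‖σ z‖ₑ ^ (40 / 9 : ℝ)) ^ (9 / 40 : ℝ)).toReal := by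
  have h := eLpNorm_top_parCyl_half_le_of_reverse_holder hσ hK hb hC H
  have hBtop : K ^ (9 / 4 : ℝ) * b ^ (45 / 4 : ℝ) *
      (∫⁻ z in SereginSverak2009.parCyl (0 : ℝ × EuclideanSpace ℝ (Fin 3)) (5 / 8),
        ‖σ z‖ₑ ^ (40 / 9 : ℝ)) ^ (9 / 40 : ℝ) ≠ ∞ :=
    ENNReal.mul_ne_top (ENNReal.mul_ne_top (ENNReal.rpow_ne_top_of_nonneg (by norm_num) hK)
      (ENNReal.rpow_ne_top_of_nonneg (by norm_num) hb)) (ENNReal.rpow_ne_top_of_nonneg (by norm_num) hfin)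
  rw [eLpNorm_exponent_top] at h
  filter_upwards [ae_le_eLpNormEssSup (f := σ)
    (μ := volume.restrict (SereginSverak2009.parCyl (0 : ℝ × EuclideanSpace ℝ (Fin 3)) (1 / 2)))]
    with z hz
  have hz' := hz.trans h
  rw [← ofReal_norm, Real.norm_eq_abs] at hz'
  exact (ENNReal.ofReal_le_iff_le_toReal hBtop).1 hz'

/-- **(2.6) as an a.e. bound on the ball-based cylinder `Q_{1/2}(0) = ]-1/4, 0[ × B(0, 1/2)`**
(`parabolicCylinder (1/2) 0 ⊆ 𝒞(1/2) × ]-1/4, 0[`), the form consumed by the rest of the proof of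
Thm 2.1 ((2.8): `Γ ∈ L_∞` for the blow-up limit). [cite: Seregin2020, proof of Thm 2.1, Step III and (2.6)] -/
theorem ae_abs_le_parabolicCylinder_half_of_reverse_holder {σ : ℝ × EuclideanSpace ℝ (Fin 3) → ℝ}
    (hσ : AEStronglyMeasurable σ
      (volume.restrict (SereginSverak2009.parCyl (0 : ℝ × EuclideanSpace ℝ (Fin 3)) (5 / 8))))
    {C : ℕ → ℝ≥0∞} {K b : ℝ≥0∞} (hK : K ≠ ∞) (hb : b ≠ ∞) (hC : ∀ k, 2 ≤ k → C k ≤ K * b ^ k)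
    (H : ∀ k : ℕ, 2 ≤ k →
      (∫⁻ z in SereginSverak2009.parCyl (0 : ℝ × EuclideanSpace ℝ (Fin 3))
          (1 / 2 + (1 / 2 : ℝ) ^ (k + 2)), ‖σ z‖ₑ ^ (10 / 3 * (4 / 3 : ℝ) ^ k)) ^ (3 / 10 : ℝ) ≤
        C k * (∫⁻ z in SereginSverak2009.parCyl (0 : ℝ × EuclideanSpace ℝ (Fin 3))
          (1 / 2 + (1 / 2 : ℝ) ^ (k + 1)), ‖σ z‖ₑ ^ (5 / 2 * (4 / 3 : ℝ) ^ k)) ^ (2 / 5 : ℝ))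
    (hfin : (∫⁻ z in SereginSverak2009.parCyl (0 : ℝ × EuclideanSpace ℝ (Fin 3)) (5 / 8),
      ‖σ z‖ₑ ^ (40 / 9 : ℝ)) ≠ ∞) :
    ∀ᵐ z ∂(volume.restrict (parabolicCylinder (1 / 2) (0 : ℝ × EuclideanSpace ℝ (Fin 3)))),
      |σ z| ≤ (K ^ (9 / 4 : ℝ) * b ^ (45 / 4 : ℝ) *
        (∫⁻ z in SereginSverak2009.parCyl (0 : ℝ × EuclideanSpace ℝ (Fin 3)) (5 / 8),
          ‖σ z‖ₑ ^ (40 / 9 : ℝ)) ^ (9 / 40 : ℝ)).toReal :=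
  ae_restrict_of_ae_restrict_of_subset (parabolicCylinder_subset_parCyl 0 (1 / 2))
    (ae_abs_le_parCyl_half_of_reverse_holder hσ hK hb hC H hfin)

/-! ### The registered sub-stub -/

/-- **Sub-stub `stub_seregin2020TypeII_moserIteration` of the crux `AxisymmetricKatoGlobal`**
(toward `stub_seregin2020TypeII`; Seregin 2020, proof of Thm 2.1, Step III `(2.5) ⇒ (2.6)`):
`eLpNorm_top_parCyl_half_le_of_reverse_holder` and
`ae_abs_le_parabolicCylinder_half_of_reverse_holder`, conjoined. [cite: Seregin2020, proof of Thm 2.1, Step III] -/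
theorem stub_seregin2020TypeII_moserIteration :
    (∀ (σ : ℝ × EuclideanSpace ℝ (Fin 3) → ℝ) (C : ℕ → ℝ≥0∞) (K b : ℝ≥0∞), K ≠ ∞ → b ≠ ∞ →
      AEStronglyMeasurable σ
        (volume.restrict (SereginSverak2009.parCyl (0 : ℝ × EuclideanSpace ℝ (Fin 3)) (5 / 8))) →
      (∀ k : ℕ, 2 ≤ k → C k ≤ K * b ^ k) →
      (∀ k : ℕ, 2 ≤ k →
        (∫⁻ z in SereginSverak2009.parCyl (0 : ℝ × EuclideanSpace ℝ (Fin 3))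
            (1 / 2 + (1 / 2 : ℝ) ^ (k + 2)), ‖σ z‖ₑ ^ (10 / 3 * (4 / 3 : ℝ) ^ k)) ^ (3 / 10 : ℝ) ≤
          C k * (∫⁻ z in SereginSverak2009.parCyl (0 : ℝ × EuclideanSpace ℝ (Fin 3))
            (1 / 2 + (1 / 2 : ℝ) ^ (k + 1)), ‖σ z‖ₑ ^ (5 / 2 * (4 / 3 : ℝ) ^ k)) ^ (2 / 5 : ℝ)) →
      eLpNorm σ ∞
          (volume.restrict (SereginSverak2009.parCyl (0 : ℝ × EuclideanSpace ℝ (Fin 3)) (1 / 2))) ≤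
        K ^ (9 / 4 : ℝ) * b ^ (45 / 4 : ℝ) *
          (∫⁻ z in SereginSverak2009.parCyl (0 : ℝ × EuclideanSpace ℝ (Fin 3)) (5 / 8),
            ‖σ z‖ₑ ^ (40 / 9 : ℝ)) ^ (9 / 40 : ℝ)) ∧
    (∀ (σ : ℝ × EuclideanSpace ℝ (Fin 3) → ℝ) (C : ℕ → ℝ≥0∞) (K b : ℝ≥0∞), K ≠ ∞ → b ≠ ∞ →
      AEStronglyMeasurable σ
        (volume.restrict (SereginSverak2009.parCyl (0 : ℝ × EuclideanSpace ℝ (Fin 3)) (5 / 8))) →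
      (∀ k : ℕ, 2 ≤ k → C k ≤ K * b ^ k) →
      (∀ k : ℕ, 2 ≤ k →
        (∫⁻ z in SereginSverak2009.parCyl (0 : ℝ × EuclideanSpace ℝ (Fin 3))
            (1 / 2 + (1 / 2 : ℝ) ^ (k + 2)), ‖σ z‖ₑ ^ (10 / 3 * (4 / 3 : ℝ) ^ k)) ^ (3 / 10 : ℝ) ≤
          C k * (∫⁻ z in SereginSverak2009.parCyl (0 : ℝ × EuclideanSpace ℝ (Fin 3))
            (1 / 2 + (1 / 2 : ℝ) ^ (k + 1)), ‖σ z‖ₑ ^ (5 / 2 * (4 / 3 : ℝ) ^ k)) ^ (2 / 5 : ℝ)) →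
      (∫⁻ z in SereginSverak2009.parCyl (0 : ℝ × EuclideanSpace ℝ (Fin 3)) (5 / 8),
          ‖σ z‖ₑ ^ (40 / 9 : ℝ)) ≠ ∞ →
      ∀ᵐ z ∂(volume.restrict (parabolicCylinder (1 / 2) (0 : ℝ × EuclideanSpace ℝ (Fin 3)))),
        |σ z| ≤ (K ^ (9 / 4 : ℝ) * b ^ (45 / 4 : ℝ) *
          (∫⁻ z in SereginSverak2009.parCyl (0 : ℝ × EuclideanSpace ℝ (Fin 3)) (5 / 8),
            ‖σ z‖ₑ ^ (40 / 9 : ℝ)) ^ (9 / 40 : ℝ)).toReal) :=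
  ⟨fun _ _ _ _ hK hb hσ hC H => eLpNorm_top_parCyl_half_le_of_reverse_holder hσ hK hb hC H,
    fun _ _ _ _ hK hb hσ hC H hfin =>
      ae_abs_le_parabolicCylinder_half_of_reverse_holder hσ hK hb hC H hfin⟩

end Summit.NavierStokesRegularity.NavierStokesRegularity.Theorems.AxisymmetricKatoGlobal.EulerScaling

end
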